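import Literature.Analysis.FluidPDE.GalerkinSmoothHm
import Literature.Analysis.FunctionSpaces.TorusSobolevNormDerivProofs
import Literature.Analysis.FunctionSpaces.TorusSymL2Synthesis
import HarnessLib

/-!
# Word derivatives of smooth real fields on `T^d` and the Sobolev weights: Plancherel bounds

Analysis/FluidPDE support file for the energy-method construction of Euler flows in the periodic
cylinder (`Literature.Analysis.FluidPDE.KatoLai1984_periodicCylinderUniformExistence`), bridging the
two currencies of Sobolev norms of a smooth real vector field `u : T^d → ℝ^d`: the **Fourier
weights** `∑_k (1 + |k|²)^m ‖û(k)‖²` (the norm of `SymL2.ofSmooth (sobolevWeight m) u`,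
`TorusSymL2Synthesis`) and the **`L²` norms of the coordinate word derivatives**
`∫ ‖∂_w u‖²`, `|w| ≤ m` (Grafakos 2014, Prop. 3.1.2 (10): `𝓕(∂ⱼ f)(k) = 2πi kⱼ f̂(k)`;
Prop. 3.2.7 (1): Plancherel):

* `Torus.wordDeriv w u = ∂_{w₁} ⋯ ∂_{w_n} u` (head outermost), smooth for smooth `u`, commuting
  with `complexify`; `mFourierCoeff_complexify_wordDeriv` — `𝓕(∂_w u)(k) = (∏ᵢ 2πi k_{wᵢ}) û(k)`;
* `integral_norm_sq_wordDeriv_eq_tsum` — **Plancherel for word derivatives**: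
  `∫ ‖∂_w u‖² = ∑_k ‖∏ᵢ 2πi k_{wᵢ}‖² ‖û(k)‖²`;
* `integral_norm_sq_wordDeriv_le` — `∫ ‖∂_w u‖² ≤ (4π²)^m ∑_k (1+|k|²)^m ‖û(k)‖²` for `|w| ≤ m`;
* `tsum_weight_mul_norm_sq_le` — conversely
  `∑_k (1+|k|²)^m ‖û(k)‖² ≤ (#d+1)^m (∫ ‖u‖² + ∑ᵢ ∫ ‖∂ᵢ^m u‖²)` (Jensen for the weights, the
  tree's `GalerkinSmooth.weight_pow_le_pureWeight`, and Plancherel for the pure words).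

Everything is proved; no named fact and no `sorry` is introduced.

## Mathlib / tree search

Tree: `Torus.partialDeriv`, `Torus.IsSmooth.partialDeriv`, `Torus.partialDeriv_complexify_comp`,
`Torus.mFourierCoeff_complexify_partialDeriv` (`TorusCalculus`, `TorusFourierCalculus`,
`TorusTrigPoly`); `Torus.tsum_enorm_sq_mFourierCoeff_eq_ofReal_integral` (Plancherel,
`TorusSobolevNormDerivProofs`); `GalerkinSmooth.weight_pow_le_pureWeight` (`GalerkinSmoothHm`);
`SymL2.hasSum_norm_sq_ofSmooth` (`TorusSymL2Synthesis`). `lean search 'wordDeriv'`: the name is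
free on the torus (`cwd` of `PDE/CoordWordDeriv` is the whole-space analogue).

## References

* L. Grafakos, *Classical Fourier Analysis*, 3rd ed., Springer 2014, Prop. 3.1.2 (10),
  Prop. 3.2.7 (1). [Grafakos2014]
-/

noncomputable section

open Filter Topology TopologicalSpace Finset MeasureTheory UnitAddTorus
open scoped ENNReal NNReal ComplexConjugate InnerProductSpace

namespace Literature.Analysis.FluidPDE

namespace Torus

open FunctionSpaces FunctionSpaces.Torus

universe u

variable {d : Type u} [Fintype d] [DecidableEq d]

/-! ### Word derivatives -/

section WordDeriv

variable {F : Type*} [NormedAddCommGroup F] [NormedSpace ℝ F]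

/-- **Coordinate word derivatives on the torus** `∂_w u = ∂_{w₁} (∂_{w₂} ( ⋯ (∂_{w_n} u)))`
(head outermost). [folklore] -/
def wordDeriv : List d → (UnitAddTorus d → F) → (UnitAddTorus d → F)
  | [], f => f
  | i :: w, f => Torus.partialDeriv i (wordDeriv w f)

omit [Fintype d] in
/-- The empty word does nothing. [folklore] -/
@[simp] theorem wordDeriv_nil (f : UnitAddTorus d → F) : wordDeriv ([] : List d) f = f := rfl

omit [Fintype d] in
/-- `∂_{i :: w} = ∂ᵢ ∂_w`. [folklore] -/
@[simp] theorem wordDeriv_cons (i : d) (w : List d) (f : UnitAddTorus d → F) :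
    wordDeriv (i :: w) f = Torus.partialDeriv i (wordDeriv w f) := rfl

/-- Word derivatives of smooth functions are smooth. [folklore] -/
theorem isSmooth_wordDeriv {f : UnitAddTorus d → F} (hf : IsSmooth f) : ∀ w : List d, IsSmooth (wordDeriv w f)
  | [] => hf
  | i :: w => (isSmooth_wordDeriv hf w).partialDeriv i

omit [Fintype d] in
/-- The pure word `[j, …, j]` is the iterated partial derivative. [folklore] -/
theorem wordDeriv_replicate (j : d) (f : UnitAddTorus d → F) : ∀ m : ℕ,
    wordDeriv (List.replicate m j) f = (Torus.partialDeriv j)^[m] f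
  | 0 => rfl
  | m + 1 => by
    rw [List.replicate_succ, wordDeriv_cons, wordDeriv_replicate j f m, Function.iterate_succ_apply']

/-- Word derivatives commute with continuous linear maps. [folklore] -/
theorem wordDeriv_clm_comp {G : Type*} [NormedAddCommGroup G] [NormedSpace ℝ G] {f : UnitAddTorus d → F}
    (hf : IsSmooth f) (L : F →L[ℝ] G) : ∀ w : List d, wordDeriv w (L ∘ f) = L ∘ wordDeriv w f
  | [] => rfl
  | i :: w => by
    funext x
    rw [wordDeriv_cons, wordDeriv_cons, wordDeriv_clm_comp hf L w, Function.comp_apply,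
      partialDeriv_clm_comp (isSmooth_wordDeriv hf w) L i x]

end WordDeriv

/-! ### Fourier coefficients of word derivatives of real fields -/

section Coeff

variable {u : UnitAddTorus d → EuclideanSpace ℝ d}

/-- The word symbol `∏ᵢ 2πi k_{wᵢ}`. [folklore] -/
def wordSymbol (w : List d) (k : d → ℤ) : ℂ := (w.map fun i => (2 * Real.pi * Complex.I * (k i : ℂ))).prod

omit [Fintype d] [DecidableEq d] in
/-- The empty symbol is `1`. [folklore] -/
@[simp] theorem wordSymbol_nil (k : d → ℤ) : wordSymbol ([] : List d) k = 1 := by simp [wordSymbol]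

omit [Fintype d] [DecidableEq d] in
/-- `σ_{i :: w}(k) = 2πi kᵢ σ_w(k)`. [folklore] -/
@[simp] theorem wordSymbol_cons (i : d) (w : List d) (k : d → ℤ) :
    wordSymbol (i :: w) k = (2 * Real.pi * Complex.I * (k i : ℂ)) * wordSymbol w k := by
  simp [wordSymbol]

omit [DecidableEq d] in
/-- `‖2πi kᵢ‖² ≤ 4π² (1 + |k|²)`. [folklore] -/
theorem norm_sq_deriv_symbol_le (k : d → ℤ) (i : d) :
    ‖(2 * Real.pi * Complex.I * (k i : ℂ))‖ ^ 2 ≤ 4 * Real.pi ^ 2 * (1 + freqNormSq k) := by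
  have h1 : ‖(2 * Real.pi * Complex.I * (k i : ℂ))‖ = 2 * Real.pi * |(k i : ℝ)| := by
    simp only [norm_mul, Complex.norm_ofNat, Complex.norm_real, Real.norm_eq_abs, Complex.norm_I, mul_one,
      Complex.norm_intCast, abs_of_pos Real.pi_pos]
  rw [h1, mul_pow, mul_pow, sq_abs]
  have h2 : (k i : ℝ) ^ 2 ≤ 1 + freqNormSq k := by
    have : (k i : ℝ) ^ 2 ≤ freqNormSq k :=
      single_le_sum (f := fun j => ((k j : ℝ)) ^ 2) (fun j _ => sq_nonneg _) (mem_univ i)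
    linarith
  nlinarith [Real.pi_pos]

omit [DecidableEq d] in
/-- **The norm of the word symbol**: `‖σ_w(k)‖² ≤ (4π²)^{|w|} (1 + |k|²)^{|w|}`. [folklore] -/
theorem norm_sq_wordSymbol_le (k : d → ℤ) : ∀ w : List d,
    ‖wordSymbol w k‖ ^ 2 ≤ (4 * Real.pi ^ 2) ^ w.length * (1 + freqNormSq k) ^ w.length
  | [] => by simp
  | i :: w => by
    rw [wordSymbol_cons, norm_mul, mul_pow, List.length_cons]
    have h1 := norm_sq_deriv_symbol_le k i
    have h2 := norm_sq_wordSymbol_le k w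
    have hf := freqNormSq_nonneg k
    calc ‖(2 * Real.pi * Complex.I * (k i : ℂ))‖ ^ 2 * ‖wordSymbol w k‖ ^ 2
        ≤ (4 * Real.pi ^ 2 * (1 + freqNormSq k)) * ((4 * Real.pi ^ 2) ^ w.length * (1 + freqNormSq k) ^ w.length) :=
          mul_le_mul h1 h2 (sq_nonneg _) (by positivity)
      _ = (4 * Real.pi ^ 2) ^ (w.length + 1) * (1 + freqNormSq k) ^ (w.length + 1) := by ring

omit [DecidableEq d] in
/-- For `|w| ≤ m`: `‖σ_w(k)‖² ≤ (4π²)^m (1 + |k|²)^m`. [folklore] -/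
theorem norm_sq_wordSymbol_le_of_length_le (k : d → ℤ) {w : List d} {m : ℕ} (hw : w.length ≤ m) :
    ‖wordSymbol w k‖ ^ 2 ≤ (4 * Real.pi ^ 2) ^ m * (1 + freqNormSq k) ^ m := by
  refine (norm_sq_wordSymbol_le k w).trans ?_
  have h4 : (1 : ℝ) ≤ 4 * Real.pi ^ 2 := by nlinarith [Real.pi_gt_three]
  have hk : (1 : ℝ) ≤ 1 + freqNormSq k := by linarith [freqNormSq_nonneg k]
  exact mul_le_mul (pow_le_pow_right₀ h4 hw) (pow_le_pow_right₀ hk hw) (by positivity) (by positivity)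

/-- **Fourier coefficients of word derivatives of a smooth real field**:
`𝓕(∂_w u)(k) = σ_w(k) û(k)`. [cite: Grafakos2014, Prop. 3.1.2 (10)] -/
theorem mFourierCoeff_complexify_wordDeriv (hu : IsSmooth u) (k : d → ℤ) : ∀ w : List d,
    mFourierCoeff (EuclideanSpace.complexify ∘ wordDeriv w u) k =
      wordSymbol w k • mFourierCoeff (EuclideanSpace.complexify ∘ u) k
  | [] => by simp
  | i :: w => by
    rw [wordDeriv_cons, mFourierCoeff_complexify_partialDeriv (isSmooth_wordDeriv hu w) i k,
      mFourierCoeff_complexify_wordDeriv hu k w, smul_smul, wordSymbol_cons]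

end Coeff

/-! ### Plancherel for word derivatives -/

section Plancherel

variable {u : UnitAddTorus d → EuclideanSpace ℝ d}

omit [DecidableEq d] in
/-- **Plancherel for a smooth real field** (real-valued form): `∫ ‖u‖² = ∑_k ‖û(k)‖²`, and the
series is summable. [cite: Grafakos2014, Prop. 3.2.7 (1)] -/
theorem hasSum_norm_sq_mFourierCoeff (hu : IsSmooth u) :
    HasSum (fun k : d → ℤ => ‖mFourierCoeff (EuclideanSpace.complexify ∘ u) k‖ ^ 2) (∫ x, ‖u x‖ ^ 2) := by
  have h := hasSum_sq_norm_mFourierCoeff_complexify (hu.memLp 2)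
  exact h

/-- **Plancherel for word derivatives**: `∫ ‖∂_w u‖² = ∑_k ‖σ_w(k)‖² ‖û(k)‖²`.
[cite: Grafakos2014, Prop. 3.1.2 (10) with Prop. 3.2.7 (1)] -/
theorem hasSum_norm_sq_wordSymbol_mul (hu : IsSmooth u) (w : List d) :
    HasSum (fun k : d → ℤ => ‖wordSymbol w k‖ ^ 2 * ‖mFourierCoeff (EuclideanSpace.complexify ∘ u) k‖ ^ 2)
      (∫ x, ‖wordDeriv w u x‖ ^ 2) := by
  have h := hasSum_norm_sq_mFourierCoeff (isSmooth_wordDeriv hu w)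
  refine h.congr_fun fun k => ?_
  rw [mFourierCoeff_complexify_wordDeriv hu k w, norm_smul, mul_pow]

/-- **`L²` norms of word derivatives by the Sobolev weight**: for `|w| ≤ m`,
`∫ ‖∂_w u‖² ≤ (4π²)^m ∑_k (1 + |k|²)^m ‖û(k)‖²`. [folklore] -/
theorem integral_norm_sq_wordDeriv_le (hu : IsSmooth u) {w : List d} {m : ℕ} (hw : w.length ≤ m) :
    ∫ x, ‖wordDeriv w u x‖ ^ 2 ≤
      (4 * Real.pi ^ 2) ^ m * ∑' k : d → ℤ, (1 + freqNormSq k) ^ m * ‖mFourierCoeff (EuclideanSpace.complexify ∘ u) k‖ ^ 2 := by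
  have hpg : SymL2.PolyGrowth (fun k : d → ℤ => sobolevWeight (m : ℝ) k) :=
    ⟨1, m, fun k => by
      have hk : (1 : ℝ) ≤ 1 + freqNormSq k := by linarith [freqNormSq_nonneg k]
      rw [abs_of_pos (sobolevWeight_pos _ _), one_mul, sobolevWeight, ← Real.rpow_natCast _ m]
      exact Real.rpow_le_rpow_of_exponent_le hk (by have : (0 : ℝ) ≤ m := Nat.cast_nonneg m; linarith)⟩
  -- summability of the weighted series (the norm of `ofSmooth`)
  have hws := SymL2.hasSum_norm_sq_ofSmooth (SymL2.IsWeight.mk (fun k => sobolevWeight_pos (m : ℝ) k)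
    (fun k => by rw [sobolevWeight, sobolevWeight, freqNormSq_neg])) hpg hu
  have hw2 : ∀ k : d → ℤ, sobolevWeight (m : ℝ) k ^ 2 = (1 + freqNormSq k) ^ m := fun k => by
    have hk : (0 : ℝ) ≤ 1 + freqNormSq k := by linarith [freqNormSq_nonneg k]
    rw [sobolevWeight, ← Real.rpow_natCast _ 2, ← Real.rpow_mul hk, show (m : ℝ) / 2 * (2 : ℕ) = m by push_cast; ring,
      Real.rpow_natCast]
  simp only [hw2] at hws
  have hs : Summable fun k : d → ℤ => (1 + freqNormSq k) ^ m * ‖mFourierCoeff (EuclideanSpace.complexify ∘ u) k‖ ^ 2 :=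
    hws.summable
  refine hasSum_le (fun k => ?_) (hasSum_norm_sq_wordSymbol_mul hu w) (hs.hasSum.mul_left _)
  rw [← mul_assoc]
  exact mul_le_mul_of_nonneg_right (norm_sq_wordSymbol_le_of_length_le k hw) (sq_nonneg _)

/-- Plancherel for the pure words: `∫ ‖∂ᵢ^m u‖² = ∑_k ((2π|kᵢ|)^m)² ‖û(k)‖²`. [folklore] -/
theorem hasSum_pure_norm_sq (hu : IsSmooth u) (i : d) (m : ℕ) :
    HasSum (fun k : d → ℤ => ((2 * Real.pi * |(k i : ℝ)|) ^ m) ^ 2 * ‖mFourierCoeff (EuclideanSpace.complexify ∘ u) k‖ ^ 2)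
      (∫ x, ‖wordDeriv (List.replicate m i) u x‖ ^ 2) := by
  refine (hasSum_norm_sq_wordSymbol_mul hu (List.replicate m i)).congr_fun fun k => ?_
  congr 1
  have h1 : ‖(2 * Real.pi * Complex.I * (k i : ℂ))‖ = 2 * Real.pi * |(k i : ℝ)| := by
    simp only [norm_mul, Complex.norm_ofNat, Complex.norm_real, Real.norm_eq_abs, Complex.norm_I, mul_one,
      Complex.norm_intCast, abs_of_pos Real.pi_pos]
  have : wordSymbol (List.replicate m i) k = (2 * Real.pi * Complex.I * (k i : ℂ)) ^ m := by
    simp [wordSymbol, List.map_replicate, List.prod_replicate]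
  rw [this, norm_pow, h1]

/-- **The Sobolev weight by the pure word derivatives** (Jensen for the weights and Plancherel):
`∑_k (1 + |k|²)^m ‖û(k)‖² ≤ (#d + 1)^m (∫ ‖u‖² + ∑ᵢ ∫ ‖∂ᵢ^m u‖²)`. [folklore] -/
theorem tsum_weight_mul_norm_sq_le (hu : IsSmooth u) (m : ℕ) :
    ∑' k : d → ℤ, (1 + freqNormSq k) ^ m * ‖mFourierCoeff (EuclideanSpace.complexify ∘ u) k‖ ^ 2 ≤
      ((Fintype.card d : ℝ) + 1) ^ m *
        ((∫ x, ‖u x‖ ^ 2) + ∑ i, ∫ x, ‖wordDeriv (List.replicate m i) u x‖ ^ 2) := by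
  have ha0 : ∀ k : d → ℤ, 0 ≤ ‖mFourierCoeff (EuclideanSpace.complexify ∘ u) k‖ ^ 2 := fun k => sq_nonneg _
  -- the right-hand side as one series
  have hR : HasSum (fun k : d → ℤ => (1 + ∑ i, ((2 * Real.pi * |(k i : ℝ)|) ^ m) ^ 2) *
      ‖mFourierCoeff (EuclideanSpace.complexify ∘ u) k‖ ^ 2)
      ((∫ x, ‖u x‖ ^ 2) + ∑ i, ∫ x, ‖wordDeriv (List.replicate m i) u x‖ ^ 2) := by
    have h0 := hasSum_norm_sq_mFourierCoeff hu
    have h1 := hasSum_sum (s := (univ : Finset d)) fun i _ => hasSum_pure_norm_sq hu i m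
    convert h0.add h1 using 1
    funext k
    rw [add_mul, one_mul, sum_mul]
  rcases Nat.eq_zero_or_pos m with rfl | hm
  · -- `m = 0`: `∑ ‖û‖² = ∫ ‖u‖² ≤ ∫ ‖u‖² + #d ∫ ‖u‖²`
    simp only [pow_zero, one_mul, List.replicate_zero, wordDeriv_nil]
    rw [(hasSum_norm_sq_mFourierCoeff hu).tsum_eq]
    have : 0 ≤ ∑ _i : d, ∫ x, ‖u x‖ ^ 2 := sum_nonneg fun i _ => integral_nonneg fun x => sq_nonneg _
    linarith
  · have hcmp : ∀ k : d → ℤ, (1 + freqNormSq k) ^ m * ‖mFourierCoeff (EuclideanSpace.complexify ∘ u) k‖ ^ 2 ≤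
        ((Fintype.card d : ℝ) + 1) ^ m * ((1 + ∑ i, ((2 * Real.pi * |(k i : ℝ)|) ^ m) ^ 2) *
          ‖mFourierCoeff (EuclideanSpace.complexify ∘ u) k‖ ^ 2) := by
      intro k
      have hJ := GalerkinSmooth.weight_pow_le_pureWeight k hm
      have hcard : ((Fintype.card d : ℝ) + 1) ^ (m - 1) ≤ ((Fintype.card d : ℝ) + 1) ^ m :=
        pow_le_pow_right₀ (by linarith [Nat.cast_nonneg (α := ℝ) (Fintype.card d)]) (Nat.sub_le m 1)
      have hP : 0 ≤ 1 + ∑ i, ((2 * Real.pi * |(k i : ℝ)|) ^ m) ^ 2 := by positivity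
      calc (1 + freqNormSq k) ^ m * ‖mFourierCoeff (EuclideanSpace.complexify ∘ u) k‖ ^ 2
          ≤ (((Fintype.card d : ℝ) + 1) ^ (m - 1) * (1 + ∑ i, ((2 * Real.pi * |(k i : ℝ)|) ^ m) ^ 2)) *
              ‖mFourierCoeff (EuclideanSpace.complexify ∘ u) k‖ ^ 2 :=
            mul_le_mul_of_nonneg_right hJ (ha0 k)
        _ ≤ (((Fintype.card d : ℝ) + 1) ^ m * (1 + ∑ i, ((2 * Real.pi * |(k i : ℝ)|) ^ m) ^ 2)) *
              ‖mFourierCoeff (EuclideanSpace.complexify ∘ u) k‖ ^ 2 :=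
            mul_le_mul_of_nonneg_right (mul_le_mul_of_nonneg_right hcard hP) (ha0 k)
        _ = _ := by ring
    have hsum : Summable fun k : d → ℤ => (1 + freqNormSq k) ^ m * ‖mFourierCoeff (EuclideanSpace.complexify ∘ u) k‖ ^ 2 :=
      (hR.summable.mul_left _).of_nonneg_of_le
        (fun k => mul_nonneg (pow_nonneg (by linarith [freqNormSq_nonneg k]) _) (ha0 k)) hcmp
    calc ∑' k : d → ℤ, (1 + freqNormSq k) ^ m * ‖mFourierCoeff (EuclideanSpace.complexify ∘ u) k‖ ^ 2
        ≤ ∑' k : d → ℤ, ((Fintype.card d : ℝ) + 1) ^ m * ((1 + ∑ i, ((2 * Real.pi * |(k i : ℝ)|) ^ m) ^ 2) *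
            ‖mFourierCoeff (EuclideanSpace.complexify ∘ u) k‖ ^ 2) :=
          hsum.tsum_le_tsum hcmp (hR.summable.mul_left _)
      _ = ((Fintype.card d : ℝ) + 1) ^ m *
            ((∫ x, ‖u x‖ ^ 2) + ∑ i, ∫ x, ‖wordDeriv (List.replicate m i) u x‖ ^ 2) := by
          rw [tsum_mul_left, hR.tsum_eq]

end Plancherel

end Torus

end Literature.Analysis.FluidPDE
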